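import Literature.MathematicalPhysics.QuantumFieldTheory.Balaban1983to89.B15Prop1WindowDirectPackageFromLetters
import Literature.MathematicalPhysics.QuantumFieldTheory.Balaban1983to89.B15Prop1RealChartFamilyAtGaugeB
import Literature.MathematicalPhysics.QuantumFieldTheory.Balaban1983to89.Node00.MultiScaleFibreChartB

/-!
# `Balaban1983to89.B15Prop1WindowDirectPackageFromLetters` — [Balaban1989LargeFieldII] p. 357, (1.12)–(1.13) p. 359 ∕ [Balaban1985Variational] (3)–(4) p. 278, (16)–(18) p. 280, — **BOND-DATUM EDITION** (`…B15Prop1WindowDirectPackageFromLettersB`, USED DECLARATIONS ONLY): the print-datum ([Balaban1984PropagatorsII] (2.3)) twins of the declarations of `B15Prop1WindowDirectPackageFromLetters` that N12's junction of record v14ᴸ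
uses with a datum-bearing statement (`hWD_of_windowLetters_on`) — class (γ) of dag-n12-c's census-by-declaration v2 (bus [DAGN12C-G35], 2026-08-30).  GENERATOR (block-extracted from the
parent's tree bytes by HOME `lean/g35/gen/gen_blocks.py`): namespace `…B`, SAME names, `DetSet ↦ BDetSet` (F0a), `AgreeOn ↦ AgreeOnB`, `IsMinimizer ↦ IsMinimizerB`, `bondsOf (𝐁 j) ↦ 𝔅 j`, `constrCard ∕
constrEnum ∕ ConstrSet ∕ msChart ↦ …B` (lane `Node00/MultiScaleFibreChartB`), `IsCritOnFibre ∕ IsFibreChartNear ↦ …B`; proofs VERBATIM; the parent's other (datum-free) declarations REUSED by `open`.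
RE-KEY NOTE (SHAPES change — for dag-n12-d's generator): binders `(bd)` before `Z Λ`, `(hbdk : ∀ i j, k i < j → bd (k i) (maxDomT ν.M₁ (Z i)) j = ∅)` and the DISPLAYED support set
`(S : ι → Set (PBond (F.P Kt) 0)) (hS : ∀ i, ∀ b ∉ S i, b ∈ bd (k i) (maxDomT ν.M₁ (Z i)) 0)` after `hk`; `hk0` GONE; `hfar`, P1's plaquette set (`hPlaq`, the (WD) conclusion) and
(χ)_W's support clause read `S i` where the parent read `{b | b.src ∈ maxDomT ν.M₁ (Z i) 1}` (LOCATED-2: under print's [II] (2.3) datum only bonds with BOTH endpoints off `Ω₁` are pinned).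

statement-level skeleton of published theorems with citation tags; proofs where landed; nothing here is a claim about the Yang–Mills mass gap

Cell `pub-ymgap` (HUMAN RULINGS D-0062 ∕ D-0149), lane `pub-ymgap-dag-n12-c` g35 (R134 seat (a), N12 = [B15], s1, lane owner); `--kind proof --supports` K1⁹ `stmt-QuantumFields-27364`; count-neutral.
THEOREMS ONLY (0 `def`, 0 `instance`, 0 `sorry`).  HONESTY GUARD (director-ym №338 (5)): PURELY ADDITIVE — the parent stays landed and true on its own text; nothing in it is edited; no displayed
premise of any consumer is deleted or weakened; every hypothesis stays a hypothesis.  Nothing of Bałaban's analysis asserted; N12 NOT discharged; K0⁷ ∕ K1⁹ NOT closed; one finite 𝕋⁴ programme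
at fixed ε — nothing continuum ∕ ℝ⁴ ∕ OS; the Yang–Mills mass gap (Clay) is NOT proved by any of this.

PARENT's DOCSTRING (mathematics and citations; read `𝐁` as the bond datum `𝔅`; title as above):
Honest framing: statement-level skeleton of published theorems with citation tags; proofs where landed; nothing here is a claim about the Yang–Mills mass gap.

Cell `pub-ymgap`, HUMAN RULINGS D-0062 ∕ D-0149, lane owner `pub-ymgap-dag-n12-c` (g20) on node N12 = [B15]; count-neutral helper of K1⁹ `stmt-QuantumFields-27364`.  Plan g87's ruling
«(b-direct) GO» and re-pen word (pub-ymgap INBOX 2026-08-28 17:18Z ∕ 18:04Z): pen (P2) of the direct road after dag-n12-w5's close — (P2a) the endpoint on the displayed package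
(`B15Prop1EndpointFromWindowDirectPackage`, p656920), (P2b-χ) the chart half (dag-n12-w4, `Summits/…/BalabanUVNodesN12DirectChartPackage`), (P2b-σ) the window gauge half and the
ASSEMBLY (this lane).  THIS FILE is the assembly: dag-n12-w5's `B15Prop1NearFlatPackageFromLettersLoc.hNFn_of_letters_N_on` (p636506) pattern — from the R-explicit (J0′) letter
(dag-n12-w5's `B15Prop1RealChartFamilyAtGauge.exists_realChartFamily_atGauge_atRecord`: a base minimiser and, at every residual gauge with the root letter, a real C² minimiser
family with (K′)'s velocity bound and support letter), a DISPLAYED window gauge letter (σ)_W (a residual gauge making the minimiser bond-wise near `1` on the window's plaquette bonds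
and on the feeds of the window box's level-`k` plaquette bonds — a BOX, always inhabitable: the producer is the window-tower axial gauge, typed separately), a DISPLAYED plaquette
letter P1 (every minimiser is plaquette-small — the class reading, gauge-invariant) and a DISPLAYED direct chart letter (χ)_W (dag-n12-w4's chart half, its own inputs discharged in
the Summits socket) — the package (WD) of `B15Prop1EndpointNearFlatLettersWindow.hcoer_of_windowLettersDirect_normalised_box` (p646359 §5) VERBATIM; then the (ii)_direct endpoint
= p656920 ∘ it.  No forest, no corridor, no `inputs`-neighbourhood `N`: nothing here reads the minimiser bond-wise off the window.

WHAT THIS FILE PROVES (no `sorry`, no definition; axioms standard).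
* §1 ★★★ `hWD_of_windowLetters_on` — the (WD) family letter from (J0′) R-explicit, (σ)_W, P1, (χ)_W (per instance, at the guarded base fields with normalised extended datum).
* §2 ★★★ `exists_domain_prop1Printed_lfVarOn_std_su2_box_intrinsic_analytic_atZSeqCoPRecord_ofThm1TorusClass_ofMinimiserFamily_ofWindowLetters_ofCoercive` — (ii)_direct:
  Prop. 1 at print's (1.74) object from (J0′) + the three displayed letter families; one term over p656920 and §1.

HONEST SCOPE.  Composition by name; (J0′), (σ)_W, P1, (χ)_W, [15] Thm 1 `h15T` and the numerics stay LETTERS; per-instance constants; count-neutral; NOT a discharge of N12; K1 NOT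
closed; one finite four-torus programme at fixed `ε = L^{-K}` — nothing continuum ∕ ℝ⁴ ∕ OS ∕ mass-gap ∕ Clay.  No `def`, no `instance`, no `sorry`.

## References
* [Balaban1989LargeFieldI] T. Bałaban, Commun. Math. Phys. 122 (1989) 175–202, (1.74) p. 192, p. 193, Prop. 1 (1.77)–(1.78) p. 194, (1.79) p. 195.
* [Balaban1989LargeFieldII] T. Bałaban, Commun. Math. Phys. 122 (1989) 355–392, p. 357, (1.7)–(1.9) p. 358, (1.12)–(1.13) p. 359.
* [Balaban1985Variational] T. Bałaban, Commun. Math. Phys. 102 (1985) 277–309, (3)–(4) p. 278, Thm 1 (8) p. 279, (16)–(18) p. 280, (172) p. 305, Prop. 9 (190) p. 309.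
* [Balaban1988Convergent] T. Bałaban, Commun. Math. Phys. 119 (1988) 243–285, (2.2) p. 255, (2.11)–(2.14) pp. 256–257.
* [Balaban1985BackgroundPropagators] T. Bałaban, Commun. Math. Phys. 99 (1985) 389–434, (3.8) p. 391, (3.10) p. 392.
-/


noncomputable section

open Set Finset Metric Filter
open scoped BigOperators Matrix RealInnerProductSpace Real InnerProductSpace Topology Matrix.Norms.L2Operator

namespace Literature.MathematicalPhysics.QuantumFieldTheory.Balaban1983to89.B15Prop1WindowDirectPackageFromLettersB

open B15Prop1WindowDirectPackageFromLetters


open B15DeterminingSetsB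

open B15DeterminingSets GaugeField B16Sect1Backgrounds B15Prop1Carrier B8Eq17ClassAkV1 BlockAveraging
open B15Prop1SliceTaylorCalculus
open B15Prop1ChartCalculusSU2 (E3)
open T4CubeChartGnomonic (SU2)
open B15Prop1ChartSU2 (su2Chart)
open B15Prop1SliceCoordinates (GaugeSlice ιA freeBonds)
open T4AdjointCovarianceUnitary (lieSU)
open T4AxialGaugeSmallField (castSite boxPlaqs boxBonds)
open B6BondElimination (unitVec)
open B6TreeGaugePoincare (curl)
open B16Eq18Proof (box mem_box)
open B15Extension193 (extend)
open B15ShellGauge193 (shellGauge)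
open B15Prop1AnalyticExtClause (cplxVec anExt)
open Literature.MathematicalPhysics.QuantumLattice (quatMatrix)
open T4HaarSU2ExpChart (imQuat)
open B16Ineq19FlatSliceChart (exists_lieSU2Coord)
open B14.Eq213MaximalDomains (side)
open B14.Eq213DetSet B14.Eq216Concrete B15Sect1Instances B15Eq177GaugeInvariance B15Eq177ValueInvariance B15Eq177ValueInvarianceCoDiv B16Sect1Wilson
open B14.Eq22Determines (blockIter IsBlockUnion)
open Literature.MathematicalPhysics.QuantumFieldTheory.BalabanImbrieJaffe1984to88.BIJ85Eq453GaugeField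
open B15Prop1RealChartFamilyAtGaugeB (exists_realChartFamily_atGauge_atRecord)
open B15Prop1EndpointFromWindowDirectPackage (exists_domain_prop1Printed_lfVarOn_std_su2_box_intrinsic_analytic_atZSeqCoPRecord_ofThm1TorusClass_ofMinimiserFamily_ofWindowDirectPackage_ofCoercive)
open Node00 (expChart msChartB constrCardB)
open T4Continuum

variable {F : T4Family}



section

/-- ★★★ **THE WINDOW∕DIRECT PACKAGE (WD) — FAMILY FORM — FROM ITS LETTER FAMILIES.**  Per instance and per guarded base field `V_k` whose extended datum is `ρn i`-near `1` on the region
box: the R-explicit (J0′) letter `hMin` gives (dag-n12-w5's `exists_realChartFamily_atGauge_atRecord`) a base minimiser `U₀` and, at every residual gauge `σ` with the root letter, a real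
`C²` family of minimisers along the slice at `σ • U₀` with (K′)'s velocity bound and support letter; the window gauge letter (σ)_W gives such a `σ` with `σ • U₀` bond-wise `δc i`-near
`1` on the window's plaquette bonds and `δW i`-near `1` on the feeds of the window box's level-`k` plaquette bonds; `σ • U₀` is a minimiser of the unshifted datum (the family at
`Y = 0`), so the plaquette letter P1 applies to it; the direct chart letter (χ)_W gives the chart rows and the Federbush letter at the velocity.  Conclusion: the (WD) package of
`B15Prop1EndpointNearFlatLettersWindow.hcoer_of_windowLettersDirect_normalised_box`, binder for binder, with the window `W i`.
[cite: Balaban1989LargeFieldII, p.357, (1.12)–(1.13) p.359; Balaban1985Variational, (3)–(4) p.278, (16)–(18) p.280, (172) p.305, Prop. 9 (190) p.309; Balaban1988Convergent, (2.2) p.255, (2.11)–(2.13) pp.256–257] -/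
theorem hWD_of_windowLetters_on (ν : Node00.Stage7Numerics) (Kt : ℕ) (h0 : 0 < (F.P Kt).d) {ι : Type}
    (bd : ℕ → (ℕ → Set (Site (F.P Kt) 0)) → BDetSet (F.P Kt))
    (Z Λ : ι → Set (Site (F.P Kt) 0)) (k : ι → ℕ) (hk : ∀ i, k i ≤ (F.P Kt).m + (F.P Kt).K)
    (hbdk : ∀ i j, k i < j → bd (k i) (maxDomT ν.M₁ (Z i)) j = ∅)
    (S : ι → Set (PBond (F.P Kt) 0)) (hS : ∀ i, ∀ b ∉ S i, b ∈ bd (k i) (maxDomT ν.M₁ (Z i)) 0)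
    (eR : ι → ℝ) (T : ∀ i, Finset (PBond (F.P Kt) (k i))) (lo hi : ι → Fin (F.P Kt).d → ℤ)
    (ext : ∀ i, GaugeField (F.P Kt) (k i) SU2 → GaugeField (F.P Kt) (k i) SU2)
    -- the normalisation region boxes and tolerances (passed through to the letters)
    (LO HI : ι → Fin (F.P Kt).d → ℤ) (ρn : ι → ℝ)
    {R 𝓐₀ : ι → ℝ} (hR : ∀ i, 0 < R i)
    -- (J0′), R-EXPLICIT: per instance one radius and one bound for every base field of the strict guard
    (hMin : ∀ i Vk, PlaqSmallOn (plaqsInside (pts (k i) (Z i ∩ (Λ i)ᶜ))) (eR i) Vk →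
      ∃ Ũ : VecField (F.P Kt) (k i) (EuclideanSpace ℂ (Fin 3)) × VecField (F.P Kt) (k i) (EuclideanSpace ℂ (Fin 3)) →
          PBond (F.P Kt) 0 → Matrix (Fin 2) (Fin 2) ℂ,
        (∀ b a c, DifferentiableOn ℂ (fun z => Ũ z b a c) (ball 0 (R i))) ∧
        (∀ z ∈ ball (0 : VecField (F.P Kt) (k i) (EuclideanSpace ℂ (Fin 3)) × VecField (F.P Kt) (k i) (EuclideanSpace ℂ (Fin 3))) (R i),
          ∀ b a c, ‖Ũ z b a c‖ ≤ 𝓐₀ i) ∧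
        ∀ p B' : VecField (F.P Kt) (k i) E3, ‖p‖ < R i → ‖B'‖ < R i → ∃ U' : GaugeField (F.P Kt) 0 SU2,
          (∀ b, Ũ (cplxVec p, cplxVec B') b = ((U' b : SU2) : Matrix (Fin 2) (Fin 2) ℂ)) ∧
            IsMinimizerB (Node00.avOfRecord F 2 Kt) (Node00.regMSCoPOfRecord F 2 ν Kt (k i) (maxDomT ν.M₁ (Z i))) (bd (k i) (maxDomT ν.M₁ (Z i)))
              (avgFamily (Node00.avOfRecord F 2 Kt) (qsstarGIter0 (k i) (expMul su2Chart B' (ext i (expMul su2Chart p Vk))))) U')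
    (hfar : ∀ i, ∀ b ∉ S i, (⟨blockIter (k i) b.src, b.dir⟩ : PBond (F.P Kt) (k i)) ∉ bondsOf (pts (k i) (Λ i)))
    {γ₀ : ℝ}
    -- the WINDOW per instance (displayed: the consumer's finite window of plaquettes around `Λ_i^{(k)}`'s towers)
    (W : ι → Finset (Plaq (F.P Kt) 0))
    {δc εc δW μc Kc τc : ι → ℝ}
    -- (σ)_W THE WINDOW GAUGE LETTER per instance: a RESIDUAL gauge of the minimiser (root letter `hu`), bond-wise `δc i`-near `1` on the window's plaquette bonds (C1_window)
    -- and `δW i`-near `1` on the feeds of the window box's level-`k` plaquette bonds (the chart half's tower letter); asked at the guarded, normalised base fields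
    (hσW : ∀ i (Vk : GaugeField (F.P Kt) (k i) SU2), PlaqSmallOn (plaqsInside (pts (k i) (Z i ∩ (Λ i)ᶜ))) (eR i) Vk →
      (∀ b ∈ (boxBonds (LO i) (HI i) : Set (PBond (F.P Kt) (k i))), dist1 (ext i Vk b) ≤ ρn i) →
      ∀ U₀ : GaugeField (F.P Kt) 0 SU2,
        IsMinimizerB (Node00.avOfRecord F 2 Kt) (Node00.regMSCoPOfRecord F 2 ν Kt (k i) (maxDomT ν.M₁ (Z i))) (bd (k i) (maxDomT ν.M₁ (Z i)))
          (avgFamily (Node00.avOfRecord F 2 Kt) (qsstarGIter0 (k i) (ext i Vk))) U₀ →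
        ∃ σ : GaugeTransf (F.P Kt) 0 SU2,
          (∀ j, j ≤ k i → ∀ b ∈ bd (k i) (maxDomT ν.M₁ (Z i)) j, toMS σ j b.src = 1 ∧ toMS σ j b.tgt = 1) ∧
          (∀ p ∈ W i, ‖((gaugeAct σ U₀ ⟨p.src, p.μ⟩ : SU2) : Matrix (Fin 2) (Fin 2) ℂ) - 1‖ ≤ δc i ∧ ‖((gaugeAct σ U₀ ⟨p.src.shift p.μ, p.ν⟩ : SU2) : Matrix (Fin 2) (Fin 2) ℂ) - 1‖ ≤ δc i ∧
            ‖((gaugeAct σ U₀ ⟨p.src.shift p.ν, p.μ⟩ : SU2) : Matrix (Fin 2) (Fin 2) ℂ) - 1‖ ≤ δc i ∧ ‖((gaugeAct σ U₀ ⟨p.src, p.ν⟩ : SU2) : Matrix (Fin 2) (Fin 2) ℂ) - 1‖ ≤ δc i) ∧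
          (∀ (ν' : Fin (F.P Kt).d), ∀ z ∈ box (fun κ => (hi i κ - lo i κ + 1).toNat + 3) (fun κ => lo i κ - 2), ∀ b₀ : PBond (F.P Kt) 0,
            (b₀ ∈ feeds (k i) (⟨(castSite z : Site (F.P Kt) (k i)), ⟨0, h0⟩⟩ : PBond (F.P Kt) (k i)) ∨
              b₀ ∈ feeds (k i) (⟨((castSite z : Site (F.P Kt) (k i))).shift ⟨0, h0⟩, ν'⟩ : PBond (F.P Kt) (k i)) ∨
              b₀ ∈ feeds (k i) (⟨((castSite z : Site (F.P Kt) (k i))).shift ν', ⟨0, h0⟩⟩ : PBond (F.P Kt) (k i)) ∨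
              b₀ ∈ feeds (k i) (⟨(castSite z : Site (F.P Kt) (k i)), ν'⟩ : PBond (F.P Kt) (k i))) →
            ‖((gaugeAct σ U₀ b₀ : SU2) : Matrix (Fin 2) (Fin 2) ℂ) - 1‖ ≤ δW i))
    -- P1 THE PLAQUETTE LETTER per instance: every (2.12) minimiser of the guarded datum is `εc i`-plaquette-small off the window on the plaquettes with a bond starting in `Ω₁(Z_i)`
    -- (gauge-invariant; the class ∕ [15] Thm 1 (8) reading)
    (hPlaq : ∀ i (Vk : GaugeField (F.P Kt) (k i) SU2), PlaqSmallOn (plaqsInside (pts (k i) (Z i ∩ (Λ i)ᶜ))) (eR i) Vk →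
      (∀ b ∈ (boxBonds (LO i) (HI i) : Set (PBond (F.P Kt) (k i))), dist1 (ext i Vk b) ≤ ρn i) →
      ∀ U₀ : GaugeField (F.P Kt) 0 SU2,
        IsMinimizerB (Node00.avOfRecord F 2 Kt) (Node00.regMSCoPOfRecord F 2 ν Kt (k i) (maxDomT ν.M₁ (Z i))) (bd (k i) (maxDomT ν.M₁ (Z i)))
          (avgFamily (Node00.avOfRecord F 2 Kt) (qsstarGIter0 (k i) (ext i Vk))) U₀ →
        (∀ p ∉ W i, ((⟨p.src, p.μ⟩ : PBond (F.P Kt) 0) ∈ S i ∨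
            (⟨p.src.shift p.μ, p.ν⟩ : PBond (F.P Kt) 0) ∈ S i ∨
            (⟨p.src.shift p.ν, p.μ⟩ : PBond (F.P Kt) 0) ∈ S i ∨
            (⟨p.src, p.ν⟩ : PBond (F.P Kt) 0) ∈ S i) →
          ‖((GaugeField.plaqHol U₀ p : SU2) : Matrix (Fin 2) (Fin 2) ℂ) - 1‖ ≤ εc i))
    -- (χ)_W THE DIRECT CHART LETTER per instance (dag-n12-w4's `N12DirectChartPackage.exists_hWD_chartHalf_of_letters` shape with its own inputs — SmallBelow, plaquette letter,
    -- the curved right inverse (P4), the chart curvature (P5) — discharged in the Summits socket): at a minimiser near-flat on the window with a C² minimiser family carrying (K′)'s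
    -- velocity bound and support letter, the rows (μ), (K) and the Federbush letter at the velocity against the window form
    (hχW : ∀ i (Vk : GaugeField (F.P Kt) (k i) SU2), PlaqSmallOn (plaqsInside (pts (k i) (Z i ∩ (Λ i)ᶜ))) (eR i) Vk →
      (∀ b ∈ (boxBonds (LO i) (HI i) : Set (PBond (F.P Kt) (k i))), dist1 (ext i Vk b) ≤ ρn i) →
      ∀ (U₀ : GaugeField (F.P Kt) 0 SU2) (Xf : GaugeSlice (pts (k i) (Λ i)) (T i) E3 → PBond (F.P Kt) 0 → lieSU (Fin 2)),
        IsMinimizerB (Node00.avOfRecord F 2 Kt) (Node00.regMSCoPOfRecord F 2 ν Kt (k i) (maxDomT ν.M₁ (Z i))) (bd (k i) (maxDomT ν.M₁ (Z i)))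
          (avgFamily (Node00.avOfRecord F 2 Kt) (qsstarGIter0 (k i) (ext i Vk))) U₀ →
        (∀ p ∈ W i, ‖((U₀ ⟨p.src, p.μ⟩ : SU2) : Matrix (Fin 2) (Fin 2) ℂ) - 1‖ ≤ δc i ∧ ‖((U₀ ⟨p.src.shift p.μ, p.ν⟩ : SU2) : Matrix (Fin 2) (Fin 2) ℂ) - 1‖ ≤ δc i ∧
            ‖((U₀ ⟨p.src.shift p.ν, p.μ⟩ : SU2) : Matrix (Fin 2) (Fin 2) ℂ) - 1‖ ≤ δc i ∧ ‖((U₀ ⟨p.src, p.ν⟩ : SU2) : Matrix (Fin 2) (Fin 2) ℂ) - 1‖ ≤ δc i) →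
        (∀ (ν' : Fin (F.P Kt).d), ∀ z ∈ box (fun κ => (hi i κ - lo i κ + 1).toNat + 3) (fun κ => lo i κ - 2), ∀ b₀ : PBond (F.P Kt) 0,
            (b₀ ∈ feeds (k i) (⟨(castSite z : Site (F.P Kt) (k i)), ⟨0, h0⟩⟩ : PBond (F.P Kt) (k i)) ∨
              b₀ ∈ feeds (k i) (⟨((castSite z : Site (F.P Kt) (k i))).shift ⟨0, h0⟩, ν'⟩ : PBond (F.P Kt) (k i)) ∨
              b₀ ∈ feeds (k i) (⟨((castSite z : Site (F.P Kt) (k i))).shift ν', ⟨0, h0⟩⟩ : PBond (F.P Kt) (k i)) ∨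
              b₀ ∈ feeds (k i) (⟨(castSite z : Site (F.P Kt) (k i)), ν'⟩ : PBond (F.P Kt) (k i))) →
            ‖((U₀ b₀ : SU2) : Matrix (Fin 2) (Fin 2) ℂ) - 1‖ ≤ δW i) →
        Xf 0 = 0 → ContDiffAt ℝ 2 Xf 0 →
        (∀ᶠ Y in 𝓝 (0 : GaugeSlice (pts (k i) (Λ i)) (T i) E3),
          IsMinimizerB (Node00.avOfRecord F 2 Kt) (Node00.regMSCoPOfRecord F 2 ν Kt (k i) (maxDomT ν.M₁ (Z i))) (bd (k i) (maxDomT ν.M₁ (Z i)))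
            (avgFamily (Node00.avOfRecord F 2 Kt) (qsstarGIter0 (k i) (expMul su2Chart (ιA (pts (k i) (Λ i)) (T i) Y) (ext i Vk)))) (expChart U₀ (Xf Y))) →
        (∀ (X : GaugeSlice (pts (k i) (Λ i)) (T i) E3) (b : PBond (F.P Kt) 0),
          ‖((fderiv ℝ Xf 0 X b : lieSU (Fin 2)) : Matrix (Fin 2) (Fin 2) ℂ)‖ ≤ 8 * 𝓐₀ i / R i * ‖X‖ ∧ ‖fderiv ℝ Xf 0 X b‖ ≤ 12 * 𝓐₀ i / R i * ‖X‖) →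
        (∀ (X : GaugeSlice (pts (k i) (Λ i)) (T i) E3), ∀ b ∉ S i, fderiv ℝ Xf 0 X b = 0) →
        ∃ (Ψ₂ : (PBond (F.P Kt) 0 → lieSU (Fin 2)) →L[ℝ] (PBond (F.P Kt) 0 → lieSU (Fin 2)) →L[ℝ] (Fin (constrCardB (bd (k i) (maxDomT ν.M₁ (Z i))) (k i)) → lieSU (Fin 2)))
          (lam : (Fin (constrCardB (bd (k i) (maxDomT ν.M₁ (Z i))) (k i)) → lieSU (Fin 2)) →L[ℝ] ℝ)
          (p : Seminorm ℝ (PBond (F.P Kt) 0 → lieSU (Fin 2))),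
          HasFDerivAt (fun Y => fderiv ℝ (msChartB F 2 Kt (k i) (bd (k i) (maxDomT ν.M₁ (Z i))) (avgFamily (Node00.avOfRecord F 2 Kt) (qsstarGIter0 (k i) (ext i Vk))) U₀) Y) Ψ₂ 0 ∧
          (∀ᶠ Y in 𝓝 (0 : PBond (F.P Kt) 0 → lieSU (Fin 2)),
            DifferentiableAt ℝ (msChartB F 2 Kt (k i) (bd (k i) (maxDomT ν.M₁ (Z i))) (avgFamily (Node00.avOfRecord F 2 Kt) (qsstarGIter0 (k i) (ext i Vk))) U₀) Y) ∧
          fderiv ℝ (fun Y : PBond (F.P Kt) 0 → lieSU (Fin 2) => wilsonAction4 (expChart U₀ Y)) 0 =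
            lam.comp (fderiv ℝ (msChartB F 2 Kt (k i) (bd (k i) (maxDomT ν.M₁ (Z i))) (avgFamily (Node00.avOfRecord F 2 Kt) (qsstarGIter0 (k i) (ext i Vk))) U₀) 0) ∧
          (∀ Y : PBond (F.P Kt) 0 → lieSU (Fin 2), ∑ b, ‖(Y b : Matrix (Fin 2) (Fin 2) ℂ)‖ ^ 2 ≤ p Y ^ 2) ∧
          ∀ X : GaugeSlice (pts (k i) (Λ i)) (T i) E3,
            lam (Ψ₂ (fderiv ℝ Xf 0 X) (fderiv ℝ Xf 0 X)) ≤ μc i * p (fderiv ℝ Xf 0 X) ^ 2 ∧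
            p (fderiv ℝ Xf 0 X) ≤ Kc i * ‖X‖ ∧
            γ₀ * (∑ z ∈ box (fun κ => (hi i κ - lo i κ + 1).toNat + 3) (fun κ => lo i κ - 2), ∑ μ : Fin (F.P Kt).d, ∑ a : Fin 3,
                  curl (fun b => ιA (pts (k i) (Λ i)) (T i) X (⟨castSite b.1, b.2⟩ : PBond (F.P Kt) (k i)) a) z ⟨0, h0⟩ μ ^ 2) - τc i * ‖X‖ ^ 2
              ≤ ((Fintype.card (Fin 2) : ℝ)⁻¹ • ∑ p ∈ W i, (innerSL ℝ (E := lieSU (Fin 2))).bilinearComp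
              (ContinuousLinearMap.proj (R := ℝ) (φ := fun _ : PBond (F.P Kt) 0 => lieSU (Fin 2)) (⟨p.src, p.μ⟩ : PBond (F.P Kt) 0) + ContinuousLinearMap.proj (R := ℝ) (φ := fun _ : PBond (F.P Kt) 0 => lieSU (Fin 2)) (⟨p.src.shift p.μ, p.ν⟩ : PBond (F.P Kt) 0)
                - ContinuousLinearMap.proj (R := ℝ) (φ := fun _ : PBond (F.P Kt) 0 => lieSU (Fin 2)) (⟨p.src.shift p.ν, p.μ⟩ : PBond (F.P Kt) 0) - ContinuousLinearMap.proj (R := ℝ) (φ := fun _ : PBond (F.P Kt) 0 => lieSU (Fin 2)) (⟨p.src, p.ν⟩ : PBond (F.P Kt) 0))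
              (ContinuousLinearMap.proj (R := ℝ) (φ := fun _ : PBond (F.P Kt) 0 => lieSU (Fin 2)) (⟨p.src, p.μ⟩ : PBond (F.P Kt) 0) + ContinuousLinearMap.proj (R := ℝ) (φ := fun _ : PBond (F.P Kt) 0 => lieSU (Fin 2)) (⟨p.src.shift p.μ, p.ν⟩ : PBond (F.P Kt) 0)
                - ContinuousLinearMap.proj (R := ℝ) (φ := fun _ : PBond (F.P Kt) 0 => lieSU (Fin 2)) (⟨p.src.shift p.ν, p.μ⟩ : PBond (F.P Kt) 0) - ContinuousLinearMap.proj (R := ℝ) (φ := fun _ : PBond (F.P Kt) 0 => lieSU (Fin 2)) (⟨p.src, p.ν⟩ : PBond (F.P Kt) 0))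
              : (PBond (F.P Kt) 0 → lieSU (Fin 2)) →L[ℝ] (PBond (F.P Kt) 0 → lieSU (Fin 2)) →L[ℝ] ℝ) (fderiv ℝ Xf 0 X) (fderiv ℝ Xf 0 X))
    : ∀ i (Vk : GaugeField (F.P Kt) (k i) SU2), PlaqSmallOn (plaqsInside (pts (k i) (Z i ∩ (Λ i)ᶜ))) (eR i) Vk →
      (∀ b ∈ (boxBonds (LO i) (HI i) : Set (PBond (F.P Kt) (k i))), dist1 (ext i Vk b) ≤ ρn i) →
      ∃ (U₀ : GaugeField (F.P Kt) 0 SU2) (Xf : GaugeSlice (pts (k i) (Λ i)) (T i) E3 → PBond (F.P Kt) 0 → lieSU (Fin 2)) (W : Finset (Plaq (F.P Kt) 0)),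
        -- C1_window
        (∀ p ∈ W, ‖((U₀ ⟨p.src, p.μ⟩ : SU2) : Matrix (Fin 2) (Fin 2) ℂ) - 1‖ ≤ δc i ∧ ‖((U₀ ⟨p.src.shift p.μ, p.ν⟩ : SU2) : Matrix (Fin 2) (Fin 2) ℂ) - 1‖ ≤ δc i ∧
            ‖((U₀ ⟨p.src.shift p.ν, p.μ⟩ : SU2) : Matrix (Fin 2) (Fin 2) ℂ) - 1‖ ≤ δc i ∧ ‖((U₀ ⟨p.src, p.ν⟩ : SU2) : Matrix (Fin 2) (Fin 2) ℂ) - 1‖ ≤ δc i) ∧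
        -- P1
        (∀ p ∉ W, ((⟨p.src, p.μ⟩ : PBond (F.P Kt) 0) ∈ S i ∨
            (⟨p.src.shift p.μ, p.ν⟩ : PBond (F.P Kt) 0) ∈ S i ∨
            (⟨p.src.shift p.ν, p.μ⟩ : PBond (F.P Kt) 0) ∈ S i ∨
            (⟨p.src, p.ν⟩ : PBond (F.P Kt) 0) ∈ S i) →
          ‖((GaugeField.plaqHol U₀ p : SU2) : Matrix (Fin 2) (Fin 2) ℂ) - 1‖ ≤ εc i) ∧
        Xf 0 = 0 ∧ ContDiffAt ℝ 2 Xf 0 ∧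
        (∀ᶠ Y in 𝓝 (0 : GaugeSlice (pts (k i) (Λ i)) (T i) E3),
          IsMinimizerB (Node00.avOfRecord F 2 Kt) (Node00.regMSCoPOfRecord F 2 ν Kt (k i) (maxDomT ν.M₁ (Z i))) (bd (k i) (maxDomT ν.M₁ (Z i)))
            (avgFamily (Node00.avOfRecord F 2 Kt) (qsstarGIter0 (k i) (expMul su2Chart (ιA (pts (k i) (Λ i)) (T i) Y) (ext i Vk)))) (expChart U₀ (Xf Y))) ∧
        ∃ (Ψ₂ : (PBond (F.P Kt) 0 → lieSU (Fin 2)) →L[ℝ] (PBond (F.P Kt) 0 → lieSU (Fin 2)) →L[ℝ] (Fin (constrCardB (bd (k i) (maxDomT ν.M₁ (Z i))) (k i)) → lieSU (Fin 2)))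
          (lam : (Fin (constrCardB (bd (k i) (maxDomT ν.M₁ (Z i))) (k i)) → lieSU (Fin 2)) →L[ℝ] ℝ)
          (p : Seminorm ℝ (PBond (F.P Kt) 0 → lieSU (Fin 2))),
          HasFDerivAt (fun Y => fderiv ℝ (msChartB F 2 Kt (k i) (bd (k i) (maxDomT ν.M₁ (Z i))) (avgFamily (Node00.avOfRecord F 2 Kt) (qsstarGIter0 (k i) (ext i Vk))) U₀) Y) Ψ₂ 0 ∧
          (∀ᶠ Y in 𝓝 (0 : PBond (F.P Kt) 0 → lieSU (Fin 2)),
            DifferentiableAt ℝ (msChartB F 2 Kt (k i) (bd (k i) (maxDomT ν.M₁ (Z i))) (avgFamily (Node00.avOfRecord F 2 Kt) (qsstarGIter0 (k i) (ext i Vk))) U₀) Y) ∧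
          fderiv ℝ (fun Y : PBond (F.P Kt) 0 → lieSU (Fin 2) => wilsonAction4 (expChart U₀ Y)) 0 =
            lam.comp (fderiv ℝ (msChartB F 2 Kt (k i) (bd (k i) (maxDomT ν.M₁ (Z i))) (avgFamily (Node00.avOfRecord F 2 Kt) (qsstarGIter0 (k i) (ext i Vk))) U₀) 0) ∧
          (∀ Y : PBond (F.P Kt) 0 → lieSU (Fin 2), ∑ b, ‖(Y b : Matrix (Fin 2) (Fin 2) ℂ)‖ ^ 2 ≤ p Y ^ 2) ∧
          ∀ X : GaugeSlice (pts (k i) (Λ i)) (T i) E3,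
            lam (Ψ₂ (fderiv ℝ Xf 0 X) (fderiv ℝ Xf 0 X)) ≤ μc i * p (fderiv ℝ Xf 0 X) ^ 2 ∧
            p (fderiv ℝ Xf 0 X) ≤ Kc i * ‖X‖ ∧
            γ₀ * (∑ z ∈ box (fun κ => (hi i κ - lo i κ + 1).toNat + 3) (fun κ => lo i κ - 2), ∑ μ : Fin (F.P Kt).d, ∑ a : Fin 3,
                  curl (fun b => ιA (pts (k i) (Λ i)) (T i) X (⟨castSite b.1, b.2⟩ : PBond (F.P Kt) (k i)) a) z ⟨0, h0⟩ μ ^ 2) - τc i * ‖X‖ ^ 2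
              ≤ ((Fintype.card (Fin 2) : ℝ)⁻¹ • ∑ p ∈ W, (innerSL ℝ (E := lieSU (Fin 2))).bilinearComp
              (ContinuousLinearMap.proj (R := ℝ) (φ := fun _ : PBond (F.P Kt) 0 => lieSU (Fin 2)) (⟨p.src, p.μ⟩ : PBond (F.P Kt) 0) + ContinuousLinearMap.proj (R := ℝ) (φ := fun _ : PBond (F.P Kt) 0 => lieSU (Fin 2)) (⟨p.src.shift p.μ, p.ν⟩ : PBond (F.P Kt) 0)
                - ContinuousLinearMap.proj (R := ℝ) (φ := fun _ : PBond (F.P Kt) 0 => lieSU (Fin 2)) (⟨p.src.shift p.ν, p.μ⟩ : PBond (F.P Kt) 0) - ContinuousLinearMap.proj (R := ℝ) (φ := fun _ : PBond (F.P Kt) 0 => lieSU (Fin 2)) (⟨p.src, p.ν⟩ : PBond (F.P Kt) 0))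
              (ContinuousLinearMap.proj (R := ℝ) (φ := fun _ : PBond (F.P Kt) 0 => lieSU (Fin 2)) (⟨p.src, p.μ⟩ : PBond (F.P Kt) 0) + ContinuousLinearMap.proj (R := ℝ) (φ := fun _ : PBond (F.P Kt) 0 => lieSU (Fin 2)) (⟨p.src.shift p.μ, p.ν⟩ : PBond (F.P Kt) 0)
                - ContinuousLinearMap.proj (R := ℝ) (φ := fun _ : PBond (F.P Kt) 0 => lieSU (Fin 2)) (⟨p.src.shift p.ν, p.μ⟩ : PBond (F.P Kt) 0) - ContinuousLinearMap.proj (R := ℝ) (φ := fun _ : PBond (F.P Kt) 0 => lieSU (Fin 2)) (⟨p.src, p.ν⟩ : PBond (F.P Kt) 0))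
              : (PBond (F.P Kt) 0 → lieSU (Fin 2)) →L[ℝ] (PBond (F.P Kt) 0 → lieSU (Fin 2)) →L[ℝ] ℝ) (fderiv ℝ Xf 0 X) (fderiv ℝ Xf 0 X) := by
  intro i Vk hV hnV
  -- Pauli coordinates of `𝔰𝔲(2)` and the (J0′) chart data at this base field
  obtain ⟨φ, hφ⟩ := exists_lieSU2Coord
  obtain ⟨Ũ, hdiff, h𝓐, hreal⟩ := hMin i Vk hV
  -- (K′): a base minimiser and the family at every residual gauge
  obtain ⟨U₀, hmin0, hfam⟩ := exists_realChartFamily_atGauge_atRecord ν Kt (hk i) bd (Z i) (Λ i) (hbdk i) (T i) φ hφ (ext i) Vk (hR i) Ũ hdiff h𝓐 hreal (S i) (hS i) (hfar i)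
  -- (σ)_W: the window gauge of the minimiser
  obtain ⟨σ, hu, hC1W, hfeeds⟩ := hσW i Vk hV hnV U₀ hmin0
  -- the family at `σ • U₀`
  obtain ⟨Xf, hX₀, hXc, hmin, hK, -, hsupp⟩ := hfam σ hu
  -- `σ • U₀` is a minimiser of the unshifted datum: the family at `Y = 0`
  have hminσ : IsMinimizerB (Node00.avOfRecord F 2 Kt) (Node00.regMSCoPOfRecord F 2 ν Kt (k i) (maxDomT ν.M₁ (Z i))) (bd (k i) (maxDomT ν.M₁ (Z i)))
      (avgFamily (Node00.avOfRecord F 2 Kt) (qsstarGIter0 (k i) (ext i Vk))) (gaugeAct σ U₀) := by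
    have h := hmin.self_of_nhds
    simpa only [map_zero, expMul_zero, hX₀, Node00.expChart_zero] using h
  -- P1 at the gauged minimiser (gauge-invariant letter, asked at every minimiser)
  have hP1 := hPlaq i Vk hV hnV (gaugeAct σ U₀) hminσ
  -- (χ)_W: the chart rows and the Federbush letter at the velocity
  obtain ⟨Ψ₂, lam, p, htail⟩ := hχW i Vk hV hnV (gaugeAct σ U₀) Xf hminσ hC1W hfeeds hX₀ hXc hmin hK hsupp
  exact ⟨gaugeAct σ U₀, Xf, W i, hC1W, hP1, hX₀, hXc, hmin, Ψ₂, lam, p, htail⟩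

end

end Literature.MathematicalPhysics.QuantumFieldTheory.Balaban1983to89.B15Prop1WindowDirectPackageFromLettersB

end
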